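import Mathlib
import Summits.Ventures.HodgeRepro2.Tier7.Line3.DominantSideOfKappa

/-!
# Tier7/Line3/KappaDataInstance — a NON-TRIVIAL `KappaData` over a real quadratic field (seat t7-x1, gen 2; the
non-vacuity clause for the typed residual, as L1-p1's `DominantSideInstance` for `DominantSide`)

`KappaData K Rep Orb PA PB` (DominantSideOfKappa, p677612) is the κ-dictionary as displayed fields. As a Prop it is
inhabited by a one-point costume whenever one label has both periods (the obligation shape; crit-2 l. 15282 / 15324).
This module supplies the witness with GENUINE arithmetic content: over any totally real number field `K` with exactly
two infinite places `w₂ ≠ w₃` (a real quadratic field) and any finite place `v₁`,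
* `Orb` = the integers of `K` whose real values at `w₂` and at `w₃` are `≥ 1` (infinite: every `n ≥ 1`, `natCast_mem`),
  `κ` = the inclusion into `K` (injective), `γ₀ = 1`;
* the level-`N` support `arith N γ ↔ γ = γ₀ ∨ |κ γ − 1|_{v₁} ≤ 2^{−N}` (a genuine congruence condition at `v₁`);
  `hcong` holds by definition, `hout` is the integrality of `κ γ − 1` at every finite place (Mathlib
  `FinitePlace.norm_le_one`), `hS` / `hT` are vacuous (`S = ∅`, no third infinite place);
* the archimedean factors `a₂ γ = (re_{w₂} κ γ)^{−3/2}`, `a₃ γ = (re_{w₃} κ γ)^{−3/2}` (weights `k₂ = k₃ = 3`, the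
  decays with `C = 1`), `a₁ = 1`; `a_γ₀ = 1 ≠ 0`;
* the finite factor `b N γ = 1` on the support, `0` off it (`ε = 1/8`, `b_bound` with `Bb = 1`, `b_γ₀ = 1`);
* the spectral side is the costume of `DominantSideInstance`: one label carrying the whole geometric total.
So every field of `KappaData` is jointly satisfiable with an INFINITE set of double cosets, a non-trivial congruence
support and genuine decays; `KappaData.exists_geom_ne_zero_of_kappaData` fires on it. It says nothing about any group,
torus, test function or period, and nothing about (N) or HC_CM; §8(d): NO.
Blind lane: Mathlib + the HodgeRepro2 prefix only; no sorry; axioms ⊆ {propext, Classical.choice, Quot.sound}.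
-/

namespace Summit.Ventures.HodgeRepro2.Tier7.Line3.KappaDataInstance

open NumberField Filter Topology
open Summit.Ventures.HodgeRepro2.Tier7.Line3.DominantSideOfKappa

variable {K : Type} [Field K] [NumberField K]

omit [NumberField K] in
/-- the real value of `1` is `1`. -/
theorem reAt_one {w : InfinitePlace K} (hw : w.IsReal) : reAt hw (1 : K) = 1 := by
  unfold reAt
  exact map_one _

/-- the double cosets of the instance: integers of `K` with real values `≥ 1` at `w₂` and at `w₃`. -/
def OrbK {w₂ w₃ : InfinitePlace K} (hw₂ : w₂.IsReal) (hw₃ : w₃.IsReal) : Type :=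
  {x : 𝓞 K // 1 ≤ reAt hw₂ (algebraMap (𝓞 K) K x) ∧ 1 ≤ reAt hw₃ (algebraMap (𝓞 K) K x)}

/-- the invariant: the inclusion into `K`. -/
def κK {w₂ w₃ : InfinitePlace K} (hw₂ : w₂.IsReal) (hw₃ : w₃.IsReal) (γ : OrbK hw₂ hw₃) : K :=
  algebraMap (𝓞 K) K γ.1

/-- `κ` is injective. -/
theorem κK_injective {w₂ w₃ : InfinitePlace K} (hw₂ : w₂.IsReal) (hw₃ : w₃.IsReal) :
    Function.Injective (κK hw₂ hw₃) :=
  fun _ _ h => Subtype.ext (IsFractionRing.injective (𝓞 K) K h)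

omit [NumberField K] in
/-- every natural number `≥ 1` lies in `Orb`: the set of double cosets is infinite. -/
theorem natCast_mem {w₂ w₃ : InfinitePlace K} (hw₂ : w₂.IsReal) (hw₃ : w₃.IsReal) (n : ℕ) (hn : 1 ≤ n) :
    1 ≤ reAt hw₂ (algebraMap (𝓞 K) K (n : 𝓞 K)) ∧ 1 ≤ reAt hw₃ (algebraMap (𝓞 K) K (n : 𝓞 K)) := by
  unfold reAt
  simp only [map_natCast]
  exact ⟨by exact_mod_cast hn, by exact_mod_cast hn⟩

/-- the dominant coset `γ₀ = 1`. -/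
def γ₀K {w₂ w₃ : InfinitePlace K} (hw₂ : w₂.IsReal) (hw₃ : w₃.IsReal) : OrbK hw₂ hw₃ :=
  ⟨1, by rw [map_one, reAt_one, reAt_one]; exact ⟨le_rfl, le_rfl⟩⟩

omit [NumberField K] in
/-- `κ γ₀ = 1`. -/
theorem κK_γ₀ {w₂ w₃ : InfinitePlace K} (hw₂ : w₂.IsReal) (hw₃ : w₃.IsReal) : κK hw₂ hw₃ (γ₀K hw₂ hw₃) = 1 := by
  unfold κK γ₀K
  exact map_one _

/-- the level-`N` support: `γ = γ₀` or `|κ γ − 1|_{v₁} ≤ 2^{−N}`. -/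
def arithK {w₂ w₃ : InfinitePlace K} (hw₂ : w₂.IsReal) (hw₃ : w₃.IsReal) (v₁ : FinitePlace K) (N : ℕ)
    (γ : OrbK hw₂ hw₃) : Prop :=
  γ = γ₀K hw₂ hw₃ ∨ v₁ (κK hw₂ hw₃ γ - κK hw₂ hw₃ (γ₀K hw₂ hw₃)) ≤ (2 : ℝ)⁻¹ ^ N

/-- the archimedean decay factor at a real place: `(re_w κ γ)^{−3/2}`. -/
noncomputable def aK {w₂ w₃ : InfinitePlace K} (hw₂ : w₂.IsReal) (hw₃ : w₃.IsReal) {w : InfinitePlace K}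
    (hw : w.IsReal) (γ : OrbK hw₂ hw₃) : ℂ :=
  ((reAt hw (κK hw₂ hw₃ γ) ^ (-(((3 : ℕ) : ℝ) / 2)) : ℝ) : ℂ)

omit [NumberField K] in
/-- the decay of `aK` in the real value, with constant `1`, for `γ` with value `≥ 1` (non-negative base). -/
theorem norm_aK_le {w₂ w₃ : InfinitePlace K} (hw₂ : w₂.IsReal) (hw₃ : w₃.IsReal) {w : InfinitePlace K}
    (hw : w.IsReal) (γ : OrbK hw₂ hw₃) (h : 0 ≤ reAt hw (κK hw₂ hw₃ γ)) :
    ‖aK hw₂ hw₃ hw γ‖ ≤ 1 * reAt hw (κK hw₂ hw₃ γ) ^ (-(((3 : ℕ) : ℝ) / 2)) := by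
  unfold aK
  rw [Complex.norm_real, Real.norm_eq_abs, abs_of_nonneg (Real.rpow_nonneg h _), one_mul]

omit [NumberField K] in
/-- `aK γ₀ = 1`. -/
theorem aK_γ₀ {w₂ w₃ : InfinitePlace K} (hw₂ : w₂.IsReal) (hw₃ : w₃.IsReal) {w : InfinitePlace K}
    (hw : w.IsReal) : aK hw₂ hw₃ hw (γ₀K hw₂ hw₃) = 1 := by
  unfold aK
  rw [κK_γ₀, reAt_one, Real.one_rpow]
  simp

open scoped Classical in
/-- the finite factor: `1` on the level-`N` support, `0` off it. -/
noncomputable def bK {w₂ w₃ : InfinitePlace K} (hw₂ : w₂.IsReal) (hw₃ : w₃.IsReal) (v₁ : FinitePlace K) (N : ℕ)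
    (γ : OrbK hw₂ hw₃) : ℂ :=
  if arithK hw₂ hw₃ v₁ N γ then 1 else 0

/-- `bK = 1` on the support. -/
theorem bK_of_arith {w₂ w₃ : InfinitePlace K} {hw₂ : w₂.IsReal} {hw₃ : w₃.IsReal} {v₁ : FinitePlace K} {N : ℕ}
    {γ : OrbK hw₂ hw₃} (h : arithK hw₂ hw₃ v₁ N γ) : bK hw₂ hw₃ v₁ N γ = 1 := by
  unfold bK
  exact if_pos h

/-- `bK = 0` off the support. -/
theorem bK_of_not_arith {w₂ w₃ : InfinitePlace K} {hw₂ : w₂.IsReal} {hw₃ : w₃.IsReal} {v₁ : FinitePlace K}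
    {N : ℕ} {γ : OrbK hw₂ hw₃} (h : ¬ arithK hw₂ hw₃ v₁ N γ) : bK hw₂ hw₃ v₁ N γ = 0 := by
  unfold bK
  exact if_neg h

/-- `γ₀` is in the support at every level. -/
theorem arithK_γ₀ {w₂ w₃ : InfinitePlace K} (hw₂ : w₂.IsReal) (hw₃ : w₃.IsReal) (v₁ : FinitePlace K) (N : ℕ) :
    arithK hw₂ hw₃ v₁ N (γ₀K hw₂ hw₃) :=
  Or.inl rfl

/-- the congruence at `v₁` on the support. -/
theorem hcongK {w₂ w₃ : InfinitePlace K} (hw₂ : w₂.IsReal) (hw₃ : w₃.IsReal) (v₁ : FinitePlace K) :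
    ∀ N γ, arithK hw₂ hw₃ v₁ N γ → v₁ (κK hw₂ hw₃ γ - κK hw₂ hw₃ (γ₀K hw₂ hw₃)) ≤ (2 : ℝ)⁻¹ ^ N := by
  intro N γ h
  rcases h with h | h
  · rw [h, sub_self, map_zero]
    positivity
  · exact h

/-- integrality at every finite place: `|κ γ − κ γ₀|_w ≤ 1`. -/
theorem houtK {w₂ w₃ : InfinitePlace K} (hw₂ : w₂.IsReal) (hw₃ : w₃.IsReal) (γ : OrbK hw₂ hw₃)
    (w : FinitePlace K) : w (κK hw₂ hw₃ γ - κK hw₂ hw₃ (γ₀K hw₂ hw₃)) ≤ 1 := by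
  unfold κK
  rw [← map_sub, ← FinitePlace.norm_embedding_eq]
  exact FinitePlace.norm_le_one K w.maximalIdeal _

open scoped Classical in
/-- **THE NON-TRIVIAL `KappaData`**: over a totally real `K` with exactly two infinite places `w₂ ≠ w₃` and any finite
place `v₁`, the κ-dictionary is inhabited by the instance above — every field with its genuine arithmetic or analytic
content, the spectral side a one-label costume. -/
noncomputable def kappaData (hK : ∀ w : InfinitePlace K, w.IsReal) {w₂ w₃ : InfinitePlace K} (hw : w₂ ≠ w₃)
    (htwo : ∀ w : InfinitePlace K, w = w₂ ∨ w = w₃) (v₁ : FinitePlace K) :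
    KappaData K Unit (OrbK (hK w₂) (hK w₃)) (fun _ => True) (fun _ => True) where
  κ := κK (hK w₂) (hK w₃)
  hκ := κK_injective (hK w₂) (hK w₃)
  γ₀ := γ₀K (hK w₂) (hK w₃)
  arith := arithK (hK w₂) (hK w₃) v₁
  v₁ := v₁
  S := ∅
  hv₁S := Finset.notMem_empty v₁
  q := 2
  hq := by norm_num
  B := fun _ => 1
  hBpos := fun w hw => absurd hw (Finset.notMem_empty w)
  hcong := hcongK (hK w₂) (hK w₃) v₁
  hS := fun _ _ _ w hw => absurd hw (Finset.notMem_empty w)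
  hout := fun _ γ _ w _ _ => houtK (hK w₂) (hK w₃) γ w
  hK := hK
  w₂ := w₂
  w₃ := w₃
  hw := hw
  Binf := 1
  hBinf := one_pos
  hT := fun _ _ _ w h₂ h₃ => by
    rcases htwo w with h | h
    · exact absurd h h₂
    · exact absurd h h₃
  a₁ := fun _ => 1
  a₂ := aK (hK w₂) (hK w₃) (hK w₂)
  a₃ := aK (hK w₂) (hK w₃) (hK w₃)
  C₁ := 1
  ha₁ := fun _ => by simp
  one_le_κ₂ := fun γ => γ.2.1
  one_le_κ₃ := fun γ => γ.2.2
  k₂ := 3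
  k₃ := 3
  hk₂ := le_rfl
  hk₃ := le_rfl
  C₂ := 1
  C₃ := 1
  hC₂ := zero_le_one
  hC₃ := zero_le_one
  ha₂ := fun γ => norm_aK_le (hK w₂) (hK w₃) (hK w₂) γ (zero_le_one.trans γ.2.1)
  ha₃ := fun γ => norm_aK_le (hK w₂) (hK w₃) (hK w₃) γ (zero_le_one.trans γ.2.2)
  a_γ₀ := by
    rw [aK_γ₀, aK_γ₀]
    simp
  ε := 1 / 8
  hε := by norm_num
  hε' := by norm_num
  b := bK (hK w₂) (hK w₃) v₁
  b_support := fun N γ h => by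
    by_contra hn
    exact h (bK_of_not_arith hn)
  b_bound := ⟨1, fun N γ h => by
    rw [bK_of_arith h, bK_of_arith (arithK_γ₀ (hK w₂) (hK w₃) v₁ N), norm_one, mul_one, one_mul]
    exact Real.one_le_rpow (by linarith [size_nonneg w₂ w₃ (κK (hK w₂) (hK w₃)) (κK (hK w₂) (hK w₃) (γ₀K (hK w₂) (hK w₃))) γ]) (by norm_num)⟩
  b_γ₀ := ⟨0, fun N _ => by rw [bK_of_arith (arithK_γ₀ (hK w₂) (hK w₃) v₁ N)]; exact one_ne_zero⟩
  spec := fun N _ => ∑' γ, (1 : ℂ) * aK (hK w₂) (hK w₃) (hK w₂) γ * aK (hK w₂) (hK w₃) (hK w₃) γ *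
    bK (hK w₂) (hK w₃) v₁ N γ
  spec_zero_A := fun _ _ h => absurd trivial h
  spec_zero_B := fun _ _ h => absurd trivial h
  identity := fun N => by
    symm
    rw [tsum_fintype, Finset.univ_unique, Finset.sum_singleton]

open scoped Classical in
/-- the geometric side of the instance is non-zero at some level (the dominant-term theorem fires on genuine
arithmetic data). -/
theorem exists_geom_ne_zero (hK : ∀ w : InfinitePlace K, w.IsReal) {w₂ w₃ : InfinitePlace K} (hw : w₂ ≠ w₃)
    (htwo : ∀ w : InfinitePlace K, w = w₂ ∨ w = w₃) (v₁ : FinitePlace K) :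
    ∃ N, ∑' γ, (kappaData hK hw htwo v₁).a γ * (kappaData hK hw htwo v₁).b N γ ≠ 0 :=
  KappaData.exists_geom_ne_zero_of_kappaData _

end Summit.Ventures.HodgeRepro2.Tier7.Line3.KappaDataInstance
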